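import Summits.CriticalPhenomena.PercolationContinuityZ3.Theses.PercNonProliferation
import Summits.CriticalPhenomena.PercolationContinuityZ3.Theses.PercAnnulusCrossing
import Literature.Barriers.CriticalPhenomena.SpanningClustersAboveSixProofs

/-!
# Disproof of `NonProliferation` — findings of the standing crux disprover

Crux `stmt-CriticalPhenomena-4444` = `PercNonProliferation.NonProliferation` (route rank 2):
`∃ M c, 0 < c ∧ ∃ᶠ n, c ≤ P_{p_c(ℤ³)}(N_n ≤ M)`, where "`N_n ≤ M`" is typed as "there are NO `M+1`
points of `B(n)`, pairwise unjoined inside `B(2n)`, each joined inside `B(2n)` to `∂ⁱⁿB(2n)`";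
`repEvent d M n` below is the complementary event "`N_n ≥ M+1`" in dimension `d`, and
`NonProliferationDim d` is the crux with `3 ↦ d` (`nonProliferationDim_three_iff : … 3 ↔ crux` is
`Iff.rfl`).

## Findings (cycle 1, 2026-08-16) — no kill in `d = 3`; the dimension is the load-bearing input

1. ENCODING is sound (no cheap kill): `repEvent` is measurable (`measurableSet_repEvent`), antitone in
   `M` (`repEvent_succ_subset`, so the crux is monotone in `M`: `nonProliferationDim_of_le`); the only
   degenerate index is `n = 0`, where `repEvent d 0 0 = univ` and `repEvent d (M+1) 0 = ∅`
   (`repEvent_zero_zero`, `repEvent_succ_zero`) — invisible under `∃ᶠ n`. For `n ≥ 1` the event and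
   its complement are both non-empty cylinder events, so the truth value is the physical one.

2. LOAD-BEARING HYPOTHESIS = "`d = 3`" (formally: some input false above six dimensions).
   `nonProliferationDim_false_above_six`: for every `d > 6` satisfying Aizenman's condition (t-c) with
   `η = 0` (`TwoPointBoundedRatio d`), `¬ NonProliferationDim d` — for EVERY `M`,
   `P_{p_c}(N_n ≥ M+1) → 1` (`real_repEvent_tendsto_one`). Bridge (`relabel_shift_mem_repEvent`):
   `M+1` distinct bulk left–right spanning clusters of `Λ_n` give, after the translation by `n e₁`,
   `M+1` points of `B(n)` joined inside `B(2n)` to `∂ⁱⁿB(2n)` (first-exit argument of the barrier file)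
   and pairwise unjoined inside `B(2n)` (else the two bulk clusters coincide); so
   `P(repEvent d M n) ≥ P(N_n^{bulk}(Λ_n) ≥ M+1) → 1` by the PROVED barrier
   `SpanningClustersAboveSix_holds` (Aizenman 1997, Thm 4 (3), `numSpanning_ge_tendsto_one`).
   Unconditionally refuted for `d ≥ 11` granted the named fact `Hara2008_etaZeroXSpace`
   (`nonProliferationDim_false_of_hara`), hence the `d`-uniform crux is false
   (`not_forall_nonProliferationDim`). CONSEQUENCE FOR PROVERS: every proof of the crux must use an
   input that fails in `d ≥ 7` under (t-c) — hyperscaling-side information specific to low dimension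
   (RSW-type seeds, pivotal sparsity, `d < 6` contact exponents); the route's supports/assembly are
   dimension-free and cannot supply it (this is the catalogued barrier `SpanningClustersAboveSix`,
   here extended from the bulk count `N_L` and the `M = 0` annulus crossing to the route's EXACT
   annulus/induced-cluster count, all `M`).

3. WHAT DOES NOT KILL IT (attacks tried, why `d = 3` resists):
   * `p ≠ p_c` variants are TRUE, not false (subcritical: `N_n = 0` w.h.p. by sharpness; supercritical:
     `N_n = 1` w.h.p. by uniqueness/Grimmett–Marstrand) — so `p = p_c` is where the content sits but
     mutating `p` gives no counterexample family.
   * `d = 2` analogue is TRUE (Aizenman 1997 Thm 3: `P_{p_c}(N ≥ k) ≤ e^{-αk²}`), `d > 6` FALSE (item 2):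
     the statement flips truth value between `d = 6` and `d = 7` (expected), and NO rigorous result
     on the law of `N_n` at `p_c(ℤ³)` exists in print (searched: Aizenman 1997, BCKS 1999,
     Cerf 2015 — distinct crossers controlled only at aspect ratio `n^{42}` —, Duminil-Copin–Ioffe–
     Velenik 2016, Hutchcroft 2020/21; numerics Sen 1996, Shchur 2000 report `N = O(1)` with fast-decaying
     multiplicities; the scaling theory of Fortunato–Aharony–Coniglio–Stauffer, PRE 70 (2004) 056116,
     eqs. (2)–(5): `⟨k⟩ ∝ L^d P_span² / S(L) ∝ L^{d-(2β+γ)/ν}`, `L`-independent for `d < 6` by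
     hyperscaling — note this is the physics form of the route's `MeanCauchySchwarz` bookkeeping
     `V² ≤ N·S`). A disproof would need `P_{p_c(ℤ³)}(N_n ≤ M) → 0` for all `M`, i.e. the `d > 6`
     signature in `d = 3`: no mechanism known; the only engine producing proliferation (second moment
     of face-to-face connections, tree-graph bound `E S ≲ L^{d+6}` vs `(E K)² ≍ L^{2d}`) needs
     `d > 6` on its face (`L^{6-d} → 0`).
   * natural STRENGTHENINGS not refutable here either: `∀ n` / `∀ᶠ n` forms, bounded mean
     `sup_n E N_n < ∞`, `1-ε` tightness — all expected true in `d = 3`; the `c = 1` form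
     (`N_n ≤ M` a.s. frequently) is false for the trivial finite-energy reason (not landed: needs
     `0 < p_c(ℤ³) < 1` cylinder positivity; no information for provers).

4. NUMERICS (kit job j007893, this seat; bond p = 0.2488126, induced clusters of `B(2n)`, 20 000 samples
   per n, evidence `numerics-j007893.md`): mean `N_n` = 9.06, 10.50, 11.41, 12.34, 12.89, 13.40, 13.67 for
   n = 2, 3, 4, 6, 8, 12, 16 (s.e. 0.02), sd 2.48 → 3.08; the fit `E N_n ≈ 14.42 − 12.05/n` holds to
   ≤ 0.07 for n ≥ 3 (increments per doubling halve: +1.48, +0.78 — a `1/n` correction, not `log n`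
   growth, which misses n = 8 by 16 s.e.). So the law looks TIGHT (limit: mean ≈ 14.4, sd ≈ 3.1,
   `P(N ≤ 14) ≈ 0.5`, `P(N ≤ 20) ≈ 0.97`): the crux is numerically SUPPORTED with `M ≈ 14, c = 1/2` —
   but (a) the planner's calibration "`P(N_n ≤ 3) ≥ 0.5`" is off by 10³ for THIS geometry
   (`P(N_n ≤ 3) ≤ 1.2·10⁻³` for n ≥ 4; the published O(1) multiplicities count left–right crossings of
   a cube, whereas the full inner box at ratio 2 carries ≈ 6·(2n/n)² ≈ 14 crossers), and (b) the
   blocking probability `u_n = P(N_n = 0)` is `0/140 000` pooled — invisible (Gaussian-tail guess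
   `u* ~ 10⁻⁶`), a warning for every statement that needs a usable `u_n ≥ c` at ratio 2 (0846, 4446,
   the BK cap `E N_n ≤ 1/u_n` of `PolynomialAssembly`, off by ~10⁵ from `E N ≈ 14`). The disprover's
   only live scenario was a slow log-DRIFT of the law (then `P(N_n ≤ M) → 0` for every `M` and the crux
   would be false): EXCLUDED up to n = 32 by the other seats' jobs in this directory (j008739, j013488:
   `E N_24 = 14.01 ± 0.04`, `E N_32 = 14.14 ± 0.055`, agreeing with mine to 0.02 at n ≤ 16; increments per
   doubling 0.81 → 0.45, ratio ≈ 2^{-0.85} = power-law finite-size correction; log drift predicts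
   `E N_32 ≈ 14.7`, off by 10 s.e.). Limit law: mean ≈ 14.6–15, sd ≈ 3.1, geometric-like upper tail
   (ratio ≈ 0.5 per step beyond k ≈ 20), n-stable — no proliferation signature up to box side 129;
   my j014406 (n ≤ 64) stays queued to double the range.

5. THE `M = 0` SLICE (what a kill must do first): `repEvent d 0 n = annulusCrossing d n`;
   `CritAnnulusNonCrossing → NonProliferation` (`nonProliferation_of_critAnnulusNonCrossing`, item
   stmt-CriticalPhenomena-0846 of route `PercAnnulusCrossing` implies the crux with `M = 0`), and
   contrapositively `¬ crux ⇒ P_{p_c}(annulusCrossing 3 n) → 1`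
   (`annulusCrossing_tendsto_one_of_not_nonProliferation`): any disproof refutes every RSW-type input on
   `ℤ³` first — numerically the critical annulus-crossing probability is a constant `< 1`.

6. `-- Targets`: none yet (no line picked, `stuck_stubs = []`).

Landed from this file: `Theorems/NonProliferation/Negative/AboveSix.lean` (p72489, items 1–2) and
`Theorems/NonProliferation/Negative/MZeroSlice.lean` (p72775, item 5).
-/

noncomputable section

namespace Summit.CriticalPhenomena.PercolationContinuityZ3.Cruxes.NonProliferation.Disproof

open MeasureTheory Filter Topology
open Literature.Probability.LatticeModels Literature.Probability.Percolation
open Literature.Barriers.CriticalPhenomena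
open scoped ENNReal

/-! ### The representative event and the `d`-dimensional crux -/

/-- "`N_n ≥ M + 1`" in dimension `d`: there are `M+1` points of `B(n)`, each joined inside `B(2n)` to
the inner vertex boundary `∂ⁱⁿB(2n)`, pairwise NOT joined inside `B(2n)` — representatives of `M+1`
distinct annulus-spanning clusters of the open graph induced on `B(2n)`. The crux's event is the
complement of `repEvent 3 M n`. -/
def repEvent (d M n : ℕ) : Set (BondConfig (Site d)) :=
  {ω | ∃ x : Fin (M + 1) → Site d, (∀ i, x i ∈ box d n) ∧
    (∀ i, ∃ y ∈ innerBoundary (zdGraph d) (box d (2 * n)),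
      ω ∈ openConnIn (↑(box d (2 * n)) : Set (Site d)) (x i) y) ∧
    ∀ i j, i ≠ j → ω ∉ openConnIn (↑(box d (2 * n)) : Set (Site d)) (x i) (x j)}

/-- The crux in dimension `d`: `∃ M c, 0 < c ∧ ∃ᶠ n, c ≤ P_{p_c(ℤ^d)}(N_n ≤ M)`. -/
def NonProliferationDim (d : ℕ) : Prop :=
  ∃ (M : ℕ) (c : ℝ), 0 < c ∧ ∃ᶠ n : ℕ in atTop,
    c ≤ (bondPercolation (zdGraph d) (criticalProbI d)).real (repEvent d M n)ᶜ

/-- The crux IS `NonProliferationDim 3`, definitionally. -/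
theorem nonProliferationDim_three_iff :
    NonProliferationDim 3 ↔
      Summit.CriticalPhenomena.PercolationContinuityZ3.Theses.PercNonProliferation.NonProliferation :=
  Iff.rfl

/-! ### Encoding checks: measurability, monotonicity in `M`, the degenerate index `n = 0` -/

/-- `repEvent d M n` is measurable (countably many representative tuples; `{x ↔ y in S}` is a
cylinder event of the finite box, `PlanarDuality.determinedBy_openConnIn`). -/
theorem measurableSet_repEvent (d M n : ℕ) : MeasurableSet (repEvent d M n) := by
  refine measurableSet_setOf.2 (Measurable.exists fun x => ?_)
  refine measurable_const.and ((Measurable.forall fun i => ?_).and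
    (Measurable.forall fun i => Measurable.forall fun j => measurable_const.imp ?_))
  · exact Measurable.exists fun y => measurable_const.and
      (PlanarDuality.determinedBy_openConnIn (box d (2 * n)) (x i) y).measurableSet_of_finset.mem
  · exact (PlanarDuality.determinedBy_openConnIn (box d (2 * n)) (x i) (x j)).measurableSet_of_finset.mem.not

/-- Dropping the last representative: `{N_n ≥ M+2} ⊆ {N_n ≥ M+1}`. -/
theorem repEvent_succ_subset (d M n : ℕ) : repEvent d (M + 1) n ⊆ repEvent d M n := by
  rintro ω ⟨x, hx, hconn, hdisj⟩
  exact ⟨fun i => x (Fin.castSucc i), fun i => hx _, fun i => hconn _,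
    fun i j hij => hdisj _ _ fun h => hij (Fin.castSucc_injective _ h)⟩

/-- `repEvent` is antitone in `M`. -/
theorem repEvent_antitone (d n : ℕ) {M M' : ℕ} (h : M ≤ M') : repEvent d M' n ⊆ repEvent d M n := by
  induction h with
  | refl => exact le_rfl
  | step _ ih => exact (repEvent_succ_subset d _ n).trans ih

/-- Hence the crux is monotone in `M`: if it holds with `M` it holds with every `M' ≥ M`
(the planner's "`∃ M`" is the weakest form; a prover may fix any convenient larger `M`). -/
theorem nonProliferationDim_of_le {d M M' : ℕ} (h : M ≤ M') {c : ℝ}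
    (hM : ∃ᶠ n : ℕ in atTop, c ≤ (bondPercolation (zdGraph d) (criticalProbI d)).real (repEvent d M n)ᶜ) :
    ∃ᶠ n : ℕ in atTop, c ≤ (bondPercolation (zdGraph d) (criticalProbI d)).real (repEvent d M' n)ᶜ := by
  refine hM.mono fun n hn => hn.trans ?_
  exact measureReal_mono (Set.compl_subset_compl.2 (repEvent_antitone d n h)) (measure_ne_top _ _)

/-- A point of `B(0)` is the origin. -/
theorem eq_zero_of_mem_box_zero {d : ℕ} {x : Site d} (hx : x ∈ box d 0) : x = 0 := by
  rw [mem_box] at hx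
  funext i
  have := hx i
  simp only [Nat.cast_zero, neg_zero] at this
  exact le_antisymm this.2 this.1

/-- Degenerate index `n = 0`, `M = 0`: the origin is its own crossing (`0 ∈ ∂ⁱⁿB(0)`), so
`repEvent d 0 0 = univ` and the crux's event is EMPTY at `n = 0` for `M = 0` (harmless under `∃ᶠ`). -/
theorem repEvent_zero_zero (d : ℕ) [NeZero d] : repEvent d 0 0 = Set.univ := by
  refine Set.eq_univ_of_forall fun ω => ?_
  have h0 : (0 : Site d) ∈ box d (2 * 0) := by rw [mem_box]; intro i; simp
  have h0' : (0 : Site d) ∈ box d 0 := by rw [mem_box]; intro i; simp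
  have hbd : (0 : Site d) ∈ innerBoundary (zdGraph d) (box d (2 * 0)) := by
    rw [mem_innerBoundary_iff]
    refine ⟨h0, Pi.single 0 1, ?_, ?_⟩
    · rw [mem_box]; intro h; have := (h 0).2; simp at this
    · rw [zdGraph_adj_iff]; exact ⟨0, Or.inl (by simp)⟩
  refine ⟨fun _ => 0, fun _ => h0', fun _ => ⟨0, hbd, openConnIn_refl (by exact_mod_cast h0)⟩,
    fun i j hij => (hij (Fin.ext (by have := i.isLt; have := j.isLt; omega))).elim⟩

/-- Degenerate index `n = 0`, `M ≥ 1`: two distinct representatives do not fit into `B(0) = {0}`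
(`{x ↔ x in S}` is reflexive), so `repEvent d (M+1) 0 = ∅` and the crux's event is FULL at `n = 0`
for `M ≥ 1` (again invisible under `∃ᶠ`; it would make an "`∀ n`" variant trivially satisfiable at
`n = 0` only, not for large `n`). -/
theorem repEvent_succ_zero (d M : ℕ) : repEvent d (M + 1) 0 = ∅ := by
  refine Set.eq_empty_of_forall_notMem fun ω => ?_
  rintro ⟨x, hx, -, hdisj⟩
  have h0 : x 0 = 0 := eq_zero_of_mem_box_zero (hx 0)
  have h1 : x 1 = 0 := eq_zero_of_mem_box_zero (hx 1)
  refine hdisj 0 1 (by simp) ?_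
  rw [h0, h1]
  exact openConnIn_refl (by rw [Finset.mem_coe, mem_box]; intro i; simp)

/-! ### The dimension is load-bearing: the `d`-dimensional crux is false above six dimensions -/

/-- **Bridge from bulk spanning clusters to annulus representatives.** If `ω ⊆ E(ℤ^d)` has at least
`M+1` distinct open clusters of `ℤ^d` meeting both faces `{x₁ = ∓n}` of `Λ_n` (bulk b.c.), then the
translate `ω + n e₁` has `M+1` points of `B(n)` (the translated left-face points), each joined INSIDE
`B(2n)` to `∂ⁱⁿB(2n)` (stop the translated bulk path to `{x₁ = 2n}` at its first visit to `∂ⁱⁿB(2n)`),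
pairwise NOT joined inside `B(2n)` (a join would merge the two bulk clusters). -/
theorem relabel_shift_mem_repEvent {d n M : ℕ} [NeZero d] {ω : BondConfig (Site d)}
    (hωE : ω ⊆ (zdGraph d).edgeSet)
    (hN : ((M + 1 : ℕ) : ℕ∞) ≤ numSpanningClusters d n ω) :
    BondConfig.relabel (sym2Equiv (Site.shift (Pi.single 0 (n : ℤ)))) ω ∈ repEvent d M n := by
  classical
  set v : Site d := Pi.single 0 (n : ℤ) with hv
  set ω' : BondConfig (Site d) := BondConfig.relabel (sym2Equiv (Site.shift v)) ω with hω'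
  -- the set of bulk spanning clusters of `Λ_n`
  set SC : Set (openGraph ω).ConnectedComponent :=
    {C | (∃ x ∈ leftFace d n, x ∈ C.supp) ∧ ∃ y ∈ rightFace d n, y ∈ C.supp} with hSC
  have hNS : numSpanningClusters d n ω = SC.encard := rfl
  -- an injection `Fin (M+1) → SC`
  have hle : (Set.univ : Set (Fin (M + 1))).encard ≤ SC.encard := by
    rw [Set.encard_univ, ENat.card_eq_coe_fintype_card, Fintype.card_fin, ← hNS]
    exact hN
  haveI : Nonempty (openGraph ω).ConnectedComponent := ⟨(openGraph ω).connectedComponentMk 0⟩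
  obtain ⟨f, hfS, hfinj⟩ := Set.Finite.exists_injOn_of_encard_le Set.finite_univ hle
  have hf : ∀ i, f i ∈ SC := fun i => hfS (Set.mem_univ i)
  have hinj : Function.Injective f := Set.injOn_univ.1 hfinj
  -- representatives on the two faces of each chosen cluster
  choose xl hxl hxlC using fun i => (hf i).1
  choose yr hyr hyrC using fun i => (hf i).2
  have hmk : ∀ i, (openGraph ω).connectedComponentMk (xl i) = f i := fun i =>
    (SimpleGraph.ConnectedComponent.mem_supp_iff _ _).1 (hxlC i)
  have hmk' : ∀ i, (openGraph ω).connectedComponentMk (yr i) = f i := fun i =>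
    (SimpleGraph.ConnectedComponent.mem_supp_iff _ _).1 (hyrC i)
  -- the translation as a graph isomorphism `openGraph ω ≃g openGraph ω'`
  let φ : openGraph ω ≃g openGraph ω' :=
    { toEquiv := Site.shift v
      map_rel_iff' := fun {a b} => openGraph_relabel_adj_iff (Site.shift v) ω a b }
  -- `ω'` is supported on lattice edges, so its open graph is a subgraph of `ℤ^d`
  have hω'sub : ω' ⊆ (zdGraph d).edgeSet := by
    intro z hz
    rw [hω', BondConfig.mem_relabel_iff] at hz
    have hzE : (sym2Equiv (Site.shift v)).symm z ∈ (zdGraph d).edgeSet := hωE hz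
    let ψ : zdGraph d ≃g zdGraph d :=
      { toEquiv := Site.shift v
        map_rel_iff' := fun {a b} => zdGraph_adj_shift_iff v a b }
    have key := sym2Equiv_mem_edgeSet_iff ψ ((sym2Equiv (Site.shift v)).symm z)
    have hz' : sym2Equiv ψ.toEquiv ((sym2Equiv (Site.shift v)).symm z) = z :=
      (sym2Equiv (Site.shift v)).apply_symm_apply z
    rw [hz'] at key
    exact key.2 hzE
  have hle' : openGraph ω' ≤ zdGraph d := openGraph_le_of_subset hω'sub
  refine ⟨fun i => xl i + v, fun i => add_single_mem_box_of_mem_leftFace (hxl i), fun i => ?_,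
    fun i j hij => ?_⟩
  · -- an open path inside `B(2n)` from `xl i + v ∈ B(n)` to `∂ⁱⁿB(2n)`
    have hreach : (openGraph ω).Reachable (xl i) (yr i) :=
      SimpleGraph.ConnectedComponent.exact ((hmk i).trans (hmk' i).symm)
    have hreach' : (openGraph ω').Reachable (xl i + v) (yr i + v) := hreach.map φ.toHom
    obtain ⟨w⟩ := hreach'
    have hxv : xl i + v ∈ box d (2 * n) :=
      box_subset_box_two_mul d n (add_single_mem_box_of_mem_leftFace (hxl i))
    have hyv : yr i + v ∈ innerBoundary (zdGraph d) (box d (2 * n)) :=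
      add_single_mem_innerBoundary_of_mem_rightFace (hyr i)
    obtain ⟨b, hb, hu, hb', hr⟩ :=
      exists_innerBoundary_reachable_of_walk_end hle' (box d (2 * n)) w hxv (fun _ => hyv)
    exact ⟨b, hb, hu, hb', hr⟩
  · -- two representatives joined inside `B(2n)` would lie in the same bulk cluster
    rintro ⟨_, _, hr⟩
    have hr' : (openGraph ω').Reachable (xl i + v) (xl j + v) :=
      hr.map (SimpleGraph.Embedding.induce (↑(box d (2 * n)) : Set (Site d))).toHom
    have hr'' : (openGraph ω).Reachable (xl i) (xl j) :=
      (SimpleGraph.Iso.reachable_iff (φ := φ)).1 hr'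
    exact hij (hinj (((hmk i).symm.trans (SimpleGraph.ConnectedComponent.sound hr'')).trans (hmk j)))

/-- **`P_{p}(N_n ≥ M+1, annulus/induced count) ≥ P_{p}(Λ_n has ≥ M+1 bulk spanning clusters)`** for
every `p`, by translation invariance (`bondPercolation_real_preimage_shift`) and the a.s. support on
lattice edges. -/
theorem real_numSpanning_ge_le_real_repEvent (d n M : ℕ) [NeZero d] (p : unitInterval) :
    (bondPercolation (zdGraph d) p).real
        {ω | ((M + 1 : ℕ) : ℕ∞) ≤ numSpanningClusters d n ω} ≤
      (bondPercolation (zdGraph d) p).real (repEvent d M n) := by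
  set v : Site d := Pi.single 0 (n : ℤ) with hv
  have hae : ∀ᵐ ω ∂(bondPercolation (zdGraph d) p),
      ω ∈ {ω | ((M + 1 : ℕ) : ℕ∞) ≤ numSpanningClusters d n ω} →
        ω ∈ BondConfig.relabel (sym2Equiv (Site.shift v)) ⁻¹' repEvent d M n := by
    have hsub : ∀ᵐ ω ∂(bondPercolation (zdGraph d) p), ω ⊆ (zdGraph d).edgeSet :=
      ProbabilityTheory.setBernoulli_ae_subset
    filter_upwards [hsub] with ω hω hN
    exact relabel_shift_mem_repEvent hω hN
  calc (bondPercolation (zdGraph d) p).real {ω | ((M + 1 : ℕ) : ℕ∞) ≤ numSpanningClusters d n ω}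
      ≤ (bondPercolation (zdGraph d) p).real
          (BondConfig.relabel (sym2Equiv (Site.shift v)) ⁻¹' repEvent d M n) :=
        ENNReal.toReal_mono (measure_ne_top _ _) (measure_mono_ae hae)
    _ = (bondPercolation (zdGraph d) p).real (repEvent d M n) :=
        bondPercolation_real_preimage_shift v p _

/-- **Above six dimensions `N_n ≥ M+1` with probability tending to one, for every `M`** (given (t-c)
with `η = 0`): the annulus-spanning box-clusters of the crux proliferate exactly like Aizenman's bulk
spanning clusters. [cite: Aizenman1997, Thm. 4 (3)] -/
theorem real_repEvent_tendsto_one (h : SpanningClustersAboveSix) {d : ℕ} [NeZero d] (hd : 6 < d)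
    (hτ : TwoPointBoundedRatio d) (M : ℕ) :
    Tendsto (fun n : ℕ => (bondPercolation (zdGraph d) (criticalProbI d)).real (repEvent d M n))
      atTop (𝓝 1) := by
  have hK := h.numSpanning_ge_tendsto_one hd hτ ((M + 1 : ℕ) : ℝ)
  have heq : ∀ n : ℕ,
      {ω : BondConfig (Site d) | ENNReal.ofReal ((M + 1 : ℕ) : ℝ) ≤ (numSpanningClusters d n ω : ℝ≥0∞)} =
        {ω | ((M + 1 : ℕ) : ℕ∞) ≤ numSpanningClusters d n ω} := by
    intro n
    ext ω
    simp only [Set.mem_setOf_eq, ENNReal.ofReal_natCast]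
    rw [← ENat.toENNReal_coe, ENat.toENNReal_le]
  simp_rw [heq] at hK
  exact tendsto_of_tendsto_of_tendsto_of_le_of_le hK tendsto_const_nhds
    (fun n => real_numSpanning_ge_le_real_repEvent d n M _) fun _ => measureReal_le_one

/-- **LOAD-BEARING: the dimension.** For every `d > 6` satisfying Aizenman's two-point condition
(t-c) with `η = 0`, the `d`-dimensional crux is false: for every `M` and `c > 0`,
`P_{p_c}(N_n ≤ M) = 1 - P(N_n ≥ M+1) → 0`, so it is eventually `< c`. Any proof of
`NonProliferation` must therefore use an input that fails above six dimensions.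
[cite: Aizenman1997, Thm. 4 (3)] -/
theorem nonProliferationDim_false_above_six (h : SpanningClustersAboveSix) {d : ℕ} [NeZero d]
    (hd : 6 < d) (hτ : TwoPointBoundedRatio d) : ¬ NonProliferationDim d := by
  rintro ⟨M, c, hc, hfreq⟩
  have h1 := real_repEvent_tendsto_one h hd hτ M
  have h2 : Tendsto (fun n : ℕ => (bondPercolation (zdGraph d) (criticalProbI d)).real (repEvent d M n)ᶜ)
      atTop (𝓝 0) := by
    have h3 := (tendsto_const_nhds (x := (1 : ℝ))).sub h1
    rw [sub_self] at h3
    refine h3.congr fun n => ?_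
    exact (probReal_compl_eq_one_sub (measurableSet_repEvent d M n)).symm
  have hev : ∀ᶠ n : ℕ in atTop,
      (bondPercolation (zdGraph d) (criticalProbI d)).real (repEvent d M n)ᶜ < c :=
    h2.eventually (eventually_lt_nhds hc)
  obtain ⟨n, hn, hn'⟩ := (hfreq.and_eventually hev).exists
  exact absurd hn (not_le.2 hn')

/-- The same, with the barrier discharged (`SpanningClustersAboveSix_holds` is a theorem of the tree):
in `d ≥ 7` the crux fails whenever (t-c) holds with `η = 0`. -/
theorem nonProliferationDim_false_of_twoPointBoundedRatio {d : ℕ} [NeZero d] (hd : 6 < d)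
    (hτ : TwoPointBoundedRatio d) : ¬ NonProliferationDim d :=
  nonProliferationDim_false_above_six SpanningClustersAboveSix_holds hd hτ

/-- **Unconditional above ten dimensions, granted Hara's `η = 0`** (the named fact
`Hara2008_etaZeroXSpace`, Heydenreich–van der Hofstad 2017 Thm 11.4): for every `d ≥ 11` the
`d`-dimensional crux is false. [cite: HeydenreichVanDerHofstad2017, Thm. 11.4] -/
theorem nonProliferationDim_false_of_hara (hH : Hara2008_etaZeroXSpace) {d : ℕ} (hd : 11 ≤ d) :
    ¬ NonProliferationDim d := by
  haveI : NeZero d := ⟨by omega⟩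
  exact nonProliferationDim_false_of_twoPointBoundedRatio (by omega) (hH.twoPointBoundedRatio hd)

/-- Refuted natural strengthening: the DIMENSION-UNIFORM crux ("in every `d ≥ 2`, boundedly many
annulus-spanning box-clusters with positive probability along a subsequence") is false, witnessed at
`d = 11` (granted Hara's `η = 0`). -/
theorem not_forall_nonProliferationDim (hH : Hara2008_etaZeroXSpace) :
    ¬ ∀ d : ℕ, 2 ≤ d → NonProliferationDim d :=
  fun hall => nonProliferationDim_false_of_hara hH le_rfl (hall 11 (by norm_num))

/-! ### The `M = 0` slice: the crux sits above `PercAnnulusCrossing.CritAnnulusNonCrossing`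

What a kill would have to do first: `¬ crux ⇒ P_{p_c}(B(n) ↔ ∂ⁱⁿB(2n) in B(2n)) → 1`, i.e. a
disproof of `NonProliferation` refutes item stmt-CriticalPhenomena-0846 (`CritAnnulusNonCrossing`,
route `PercAnnulusCrossing`) on the way — the annulus crossing probability at `p_c(ℤ³)` is numerically
a constant `< 1` (wrapping/crossing ratios, Wang et al. arXiv:1302.0421), so the cheapest conceivable
kill is already implausible at `M = 0`. -/

/-- The `M = 0` representative event is the annulus-crossing event `{B(n) ↔ ∂ⁱⁿB(2n) in B(2n)}` of the
barrier file (`Literature.Barriers.CriticalPhenomena.annulusCrossing`). -/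
theorem repEvent_zero_eq_annulusCrossing (d n : ℕ) : repEvent d 0 n = annulusCrossing d n := by
  ext ω
  constructor
  · rintro ⟨x, hx, hconn, -⟩
    obtain ⟨y, hy, h⟩ := hconn 0
    exact ⟨x 0, hx 0, y, hy, h⟩
  · rintro ⟨x, hx, y, hy, h⟩
    exact ⟨fun _ => x, fun _ => hx, fun _ => ⟨y, hy, h⟩,
      fun i j hij => (hij (Fin.ext (by have := i.isLt; have := j.isLt; omega))).elim⟩

/-- `CritAnnulusNonCrossing` (stmt-CriticalPhenomena-0846) is, verbatim, a uniform bound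
`P_{p_c}(annulusCrossing 3 n) ≤ 1 - c` for `n ≥ 1`. -/
theorem critAnnulusNonCrossing_iff :
    Summit.CriticalPhenomena.PercolationContinuityZ3.Theses.PercAnnulusCrossing.CritAnnulusNonCrossing ↔
      ∃ c : ℝ, 0 < c ∧ ∀ n : ℕ, 1 ≤ n →
        (bondPercolation (zdGraph 3) (criticalProbI 3)).real (annulusCrossing 3 n) ≤ 1 - c :=
  Iff.rfl

/-- **`CritAnnulusNonCrossing → NonProliferation`** (with `M = 0`): the crux is implied by the rank-3
crux of route `PercAnnulusCrossing`. (Positive glue recorded for the provers; ~ the grounder's remark.) -/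
theorem nonProliferation_of_critAnnulusNonCrossing
    (h : Summit.CriticalPhenomena.PercolationContinuityZ3.Theses.PercAnnulusCrossing.CritAnnulusNonCrossing) :
    Summit.CriticalPhenomena.PercolationContinuityZ3.Theses.PercNonProliferation.NonProliferation := by
  obtain ⟨c, hc, hb⟩ := h
  refine nonProliferationDim_three_iff.1 ⟨0, c, hc, Filter.Eventually.frequently ?_⟩
  filter_upwards [Filter.eventually_ge_atTop 1] with n hn
  rw [probReal_compl_eq_one_sub (measurableSet_repEvent 3 0 n), repEvent_zero_eq_annulusCrossing]
  have hb' : (bondPercolation (zdGraph 3) (criticalProbI 3)).real (annulusCrossing 3 n) ≤ 1 - c := hb n hn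
  linarith

/-- **Contrapositive, the disprover's first hurdle**: if the crux FAILS then the critical annulus is
crossed with probability tending to one (`M = 0` slice), refuting `CritAnnulusNonCrossing` and every
RSW-type input at once. -/
theorem annulusCrossing_tendsto_one_of_not_nonProliferation
    (h : ¬ Summit.CriticalPhenomena.PercolationContinuityZ3.Theses.PercNonProliferation.NonProliferation) :
    Tendsto (fun n : ℕ => (bondPercolation (zdGraph 3) (criticalProbI 3)).real (annulusCrossing 3 n))
      atTop (𝓝 1) := by
  rw [← nonProliferationDim_three_iff] at h
  have hev : ∀ c : ℝ, 0 < c → ∀ᶠ n : ℕ in atTop,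
      (bondPercolation (zdGraph 3) (criticalProbI 3)).real (repEvent 3 0 n)ᶜ < c := by
    intro c hc
    have : ¬ ∃ᶠ n : ℕ in atTop, c ≤ (bondPercolation (zdGraph 3) (criticalProbI 3)).real (repEvent 3 0 n)ᶜ :=
      fun hf => h ⟨0, c, hc, hf⟩
    simpa [Filter.not_frequently, not_le] using this
  have h0 : Tendsto (fun n : ℕ => (bondPercolation (zdGraph 3) (criticalProbI 3)).real (repEvent 3 0 n)ᶜ)
      atTop (𝓝 0) := by
    refine tendsto_order.2 ⟨fun a ha => Filter.Eventually.of_forall fun n => lt_of_lt_of_le ha measureReal_nonneg,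
      fun a ha => hev a ha⟩
  have h1 := (tendsto_const_nhds (x := (1 : ℝ))).sub h0
  rw [sub_zero] at h1
  refine h1.congr fun n => ?_
  rw [probReal_compl_eq_one_sub (measurableSet_repEvent 3 0 n), sub_sub_cancel,
    repEvent_zero_eq_annulusCrossing]

/-! ### Near-misses / why `d = 3` resists (no sorries: nothing formal is claimed here)

* A kill needs `∀ M, P_{p_c(ℤ³)}(N_n ≤ M) → 0`. The only proliferation engine (second moment of
  face-to-face connected pairs against the tree-graph bound, `SpanningClustersAboveSixProofs`) yields
  `N_L ≳ (E K)²/E S ≍ L^{2d}/L^{d+6} = L^{d-6}`, useless for `d ≤ 6`; with the `d = 3` numbers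
  (`τ(x,y) ≍ |x-y|^{-(1+η)}`, `η ≈ -0.05`; `E S` governed by hyperscaling) the same bookkeeping gives
  `N = O(1)`, consistent with the crux.
* `p`-mutation gives no counterexample family (both off-critical regimes satisfy the statement).
* Junk/degenerate models: none available — the measure, graph and `p_c` are fixed constants of the
  statement; only `n` is free and `n = 0` is absorbed by `∃ᶠ`.
-/

-- Targets: (none — no line picked yet; stuck_stubs = [])

end Summit.CriticalPhenomena.PercolationContinuityZ3.Cruxes.NonProliferation.Disproof

end
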